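/-
Origin: expansion seat `literature-prover-pub-hodgecm-cf-hasseminkowski-g6-0`, handover #1(d) 2026-08-18T07:59:33Z (`HOME/pub-hodgecm-cf-hasseminkowski-g6/handover/HodgeCM/Literature/QuadraticCharacterSmoke.lean`, md5 73672c1e, 57 lines);
landed by the gen-7 packager in gate run 26 as `HodgeCM/Literature/QuadraticCharacterSmoke.lean` (verbatim).
-/
/-
Origin: CITED-FACT seat (4), unit `pub-hodgecm-cf-hasseminkowski-g6` (session literature-prover-pub-hodgecm-cf-hasseminkowski-g6-0),
HodgeCM publication cell, 2026-08-18.  Intended landing: `HodgeCM/Literature/QuadraticCharacterSmoke.lean` (after `QuadraticCharacterCM.lean`).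
OPTIONAL smoke / non-vacuity file: nothing imports it.
-/
import Summits.HodgeConjecture.HodgeCM.Literature.QuadraticCharacterCM
import Mathlib.NumberTheory.Cyclotomic.Basic

/-!
# Smoke test: N15 instantiated at the CM field `ℚ(ζ₅)`

The hypotheses `[NumberField L] [IsCMField L]` of `QuadraticCharacterCM.lean` are jointly satisfiable and
all instances resolve for a concrete field: `L = CyclotomicField 5 ℚ` (CM by Mathlib's
`IsCyclotomicExtension.Rat.isCMField`).  The examples below are the N15 theorems at that field; they
assert nothing new.
-/

set_option autoImplicit false

noncomputable section

open NumberField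

namespace NumberField.QuadraticCharacterSmoke

/-- (Ported verbatim from the HodgeCMPerL package; no docstring in the source.) -/
instance : IsCyclotomicExtension {5} ℚ (CyclotomicField 5 ℚ) := CyclotomicField.isCyclotomicExtension 5 ℚ

/-- (Ported verbatim from the HodgeCMPerL package; no docstring in the source.) -/
instance : IsCMField (CyclotomicField 5 ℚ) :=
  IsCyclotomicExtension.Rat.isCMField (CyclotomicField 5 ℚ) (S := {5}) ⟨5, rfl, by norm_num⟩

/-- `ε_{ℚ(ζ₅)/ℚ(√5)}` is continuous. -/
example : Continuous (quadraticCharacterCM (CyclotomicField 5 ℚ)) := continuous_quadraticCharacterCM _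

/-- A unitary Hecke character of `ℚ(ζ₅)` of infinity type `(3, 3)` restricting to `ε` on `C_{ℚ(√5)}`. -/
example : ∃ ψ : UnitaryHeckeCharacter (CyclotomicField 5 ℚ),
    ψ.HasInfinityType (CyclotomicField 5 ℚ) (fun _ => 3) ∧
      ∀ a, ψ (classBaseChange (maximalRealSubfield (CyclotomicField 5 ℚ)) (CyclotomicField 5 ℚ) a) =
        quadraticCharacterCM (CyclotomicField 5 ℚ) a :=
  exists_unitaryHeckeCharacter_of_isCMField_odd (CyclotomicField 5 ℚ) (m := 3) ⟨1, by norm_num⟩ _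
    (fun _ => Int.ModEq.refl 3)

/-- `ε` is `sgn × sgn` on `(ℚ(√5) ⊗ ℝ)^× = ℝ^× × ℝ^×`. -/
example (y : (InfiniteAdeleRing (maximalRealSubfield (CyclotomicField 5 ℚ)))ˣ) :
    quadraticCharacterCM (CyclotomicField 5 ℚ) (infUnitsToClass _ y) =
      infinityTypeChar (maximalRealSubfield (CyclotomicField 5 ℚ)) (fun _ => 1) y := by
  simpa using quadraticCharacterCM_infUnitsToClass_zpow (CyclotomicField 5 ℚ) 1 y

/-- The five splitting characters with `(m_W, m_1, m_3) = (2, 1, 3)` and constant types. -/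
example : ∃ μW μ₁ μ₂ μ₃ μ₄ : UnitaryHeckeCharacter (CyclotomicField 5 ℚ), μ₁ * μ₂ = μW ∧ μ₃ * μ₄ = μW := by
  obtain ⟨μW, μ₁, μ₂, μ₃, μ₄, -, -, -, -, -, -, -, -, -, -, h12, h34⟩ :=
    exists_splittingCharacters (CyclotomicField 5 ℚ) 2 1 3 (fun _ => 2) (fun _ => 1) (fun _ => 3)
      (fun _ => Int.ModEq.refl 2) (fun _ => Int.ModEq.refl 1) (fun _ => Int.ModEq.refl 3)
  exact ⟨μW, μ₁, μ₂, μ₃, μ₄, h12, h34⟩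

end NumberField.QuadraticCharacterSmoke

end
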